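import Summits.QuantumFields.YangMills.Theorems.ParabolicTrajectoryTunedSequenceExistsMirrorBound
import Summits.QuantumFields.YangMills.Theorems.ParabolicTrajectoryTunedSequenceExistsMirrorDefs
import Summits.QuantumFields.YangMills.Theorems.LangevinControlUVFemtoCurvatureTwoPointCDefs
import Literature.MathematicalPhysics.QuantumLattice.LatticeGaugeDLRFreeEnergyProofs

/-!
# `TunedSequenceExists` (stmt-QuantumFields-10524), line `fixed-aspect-window`:
# the last mile, part 1 (core) — the plaquette-pair ceiling predicate, on-axis torus distances,
# the corner densities as 36 torus plaquette functions, and the one-term / 36-term bounds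

Seat c4 (lead), `--supports stmt-QuantumFields-10524`.  Every ultraviolet-stability statement with one
curvature insertion is (and will be) stated PLAQUETTE-PAIRWISE, in the format of clause 3 of the sibling
crux `Summit.QuantumFields.YangMills.Theses.LangevinControlUV.FemtoCurvatureTwoPointC`
(`FemtoCurvatureTwoPointC.CruxCAt r`, landed defs): for torus plaquette deficits
`P x i j U = N − Re tr r(U_{∂p(x;i,j)})`,
`|cov_{β,L}(P x i j, P y i' j')| · dist(x,y)⁸ ≤ C` (`x ≠ y`, `i ≠ j`, `i' ≠ j'`, `dist` the Euclidean torus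
distance).  This file and its sequel `…PairCeiling.lean` convert such a ceiling on the odd torus `2L+1` into
the two registered mirror stubs of the line.  Here (part 1):

* `PairCeilingAt r β L C` — the predicate (clause 3 of `CruxCAt` at one `(L, β)`, zeta-reduced, `Γ ≤ 1`
  absorbed; a hypothesis SHAPE with parameters, not a fact);
* `curvature_shift_torusLift_eq_sum`, `mirror_shift_torusLift_eq_sum` — `P(τ_{-w}Ũ)` and `Pᴿ(τ_{-w}Ũ)` as sums
  of six torus plaquette functions (electric ones of the mirror one step down);
* `torusDist_axis`, `proj_single_ne` — on-axis torus distances `|m|` for `a − b ≡ m`, `|m| ≤ L`;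
* `abs_cov_reTr_le`, `abs_cov_axis_le` — one term: `|cov| ≤ C / dist⁸` (the deficit `N − Re tr` has the same
  covariance as `Re tr`); `abs_cov_sum_sum_le` — the 36-term bound.

References: Osterwalder–Seiler 1978 §2; Bałaban CMP 122-II p. 356 (observables deferred).
-/

noncomputable section

open MeasureTheory ProbabilityTheory Finset Filter Topology
open Literature.MathematicalPhysics.QuantumFieldTheory hiding Site ZdEdge
open Literature.MathematicalPhysics.QuantumLattice
open Literature.Probability.LatticeModels hiding configShift configShift_apply
open Summit.QuantumFields.YangMills.Theorems.FiniteSusceptibilityWeakCoupling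
open Summit.QuantumFields.YangMills.Theorems.FiniteSusceptibilityWeakCoupling.MirrorDominationAxis0

namespace Summit.QuantumFields.YangMills.Theorems.TunedSequenceExists.PairCeiling

variable {G : Type} [Group G] [TopologicalSpace G] [IsTopologicalGroup G] [CompactSpace G]
  [MeasurableSpace G] [BorelSpace G]

/-! ## The corner densities read on the periodic lift, as sums of torus plaquette functions -/

omit [TopologicalSpace G] [IsTopologicalGroup G] [CompactSpace G] [BorelSpace G] in
/-- A plaquette observable of `ℤ⁴` read on a translate of the periodic lift is the torus plaquette
function at the projected site: `Re tr ρ((τ_{-w} Ũ)_{∂p(x;i,j)}) = Re tr ρ(U_{∂p(π(x+w);i,j)})`. [folklore] -/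
theorem plaquetteObs_shift_torusLift {N : ℕ} (ρ : G →* Matrix (Fin N) (Fin N) ℂ) (L : ℕ)
    (w x : Site 4) (i j : Fin 4) (U : GaugeConfig 4 L G) :
    plaquetteObs ρ x i j (configShift (-w) (torusLift L U)) =
      (ρ (plaquetteHolonomy U (Torus.proj L (x + w)) i j)).trace.re := by
  have h : plaquetteObs ρ x i j (configShift (-w) (torusLift L U)) =
      plaquetteObs ρ (x + w) i j (torusLift L U) := by
    simp only [plaquetteObs, plaquetteHolonomyZd, configShift_apply, sub_neg_eq_add, add_right_comm]
  rw [h, plaquetteObs, Literature.MathematicalPhysics.QuantumLattice.FreeEnergy.plaquetteHolonomyZd_torusLift]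

/-- The corner density on a translate of the lift: `P(τ_{-w} Ũ) = Σ_{i<j} Re tr ρ(U_{∂p(π w; i, j)})`.
[folklore] -/
theorem curvature_shift_torusLift_eq_sum (r : LatticeRep G) (L : ℕ) (w : Site 4)
    (U : GaugeConfig 4 L G) :
    r.curvature.F (configShift (-w) (torusLift L U)) =
      ∑ q : {q : Fin 4 × Fin 4 // q.1 < q.2},
        (r.ρ (plaquetteHolonomy U (Torus.proj L w) q.1.1 q.1.2)).trace.re := by
  show actionDensity r.ρ _ = _
  rw [actionDensity_eq_sum_subtype]
  refine Finset.sum_congr rfl fun q _ => ?_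
  rw [plaquetteObs_shift_torusLift, zero_add]

/-- The MIRROR corner density on a translate of the lift: magnetic plaquettes at `π w`, electric ones one
step down, at `π (w − e₀)` (`actionDensity_cfgReflect`). [cite: OsterwalderSeiler1978, §2] -/
theorem mirror_shift_torusLift_eq_sum (r : LatticeRep G) (L : ℕ) (w : Site 4) (U : GaugeConfig 4 L G) :
    r.curvature.F (cfgReflect (configShift (-w) (torusLift L U))) =
      ∑ q : {q : Fin 4 × Fin 4 // q.1 < q.2},
        (r.ρ (plaquetteHolonomy U
          (Torus.proj L (if q.1.1 = 0 then w - Pi.single 0 1 else w)) q.1.1 q.1.2)).trace.re := by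
  show actionDensity r.ρ _ = _
  rw [actionDensity_cfgReflect r.ρ r.continuous]
  refine Finset.sum_congr rfl fun q _ => ?_
  by_cases hq : q.1.1 = 0
  · simp only [hq, ↓reduceIte]
    rw [configShift_configShift, show (Pi.single 0 1 : Site 4) + -w = -(w - Pi.single 0 1) by abel,
      plaquetteObs_shift_torusLift, zero_add]
  · simp only [hq, ↓reduceIte]
    rw [plaquetteObs_shift_torusLift, zero_add]

/-! ## Torus distances of on-axis separations -/

/-- On the odd torus `2L+1` an integer `m` with `|m| ≤ L` is its own minimal residue. [folklore] -/
theorem valMinAbs_intCast_of_abs_le (L : ℕ) {m : ℤ} (hm : |m| ≤ L) :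
    ((m : ZMod (2 * L + 1))).valMinAbs = m := by
  rw [ZMod.valMinAbs_spec]
  have := abs_le.1 hm
  refine ⟨rfl, ?_, ?_⟩ <;> push_cast <;> omega

/-- Coordinates of the difference of two on-axis torus sites `π(a e₀) − π(b e₀)`: `a − b` in the time
coordinate, `0` elsewhere. [folklore] -/
theorem proj_single_sub_proj_single_apply (L : ℕ) (a b : ℤ) (k : Fin 4) :
    (Torus.proj (2 * L + 1) (Pi.single 0 a) : Fin 4 → ZMod (2 * L + 1)) k -
      (Torus.proj (2 * L + 1) (Pi.single 0 b) : Fin 4 → ZMod (2 * L + 1)) k =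
      if k = 0 then (((a - b : ℤ)) : ZMod (2 * L + 1)) else 0 := by
  by_cases hk : k = 0
  · subst hk; simp [Torus.proj_apply]
  · simp [Torus.proj_apply, hk]

/-- **On-axis torus distance.** If `a − b ≡ m (mod 2L+1)` with `|m| ≤ L`, the Euclidean torus distance
between `π(a e₀)` and `π(b e₀)` on the odd torus `2L+1` is `|m|`. [folklore] -/
theorem torusDist_axis (L : ℕ) {a b m : ℤ} (hab : ((a - b : ℤ) : ZMod (2 * L + 1)) = (m : ZMod (2 * L + 1)))
    (hm : |m| ≤ L) :
    Real.sqrt (∑ k : Fin 4, ((((Torus.proj (2 * L + 1) (Pi.single 0 a) : Fin 4 → ZMod (2 * L + 1)) k -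
      (Torus.proj (2 * L + 1) (Pi.single 0 b) : Fin 4 → ZMod (2 * L + 1)) k).valMinAbs : ℤ) : ℝ) ^ 2) =
      |(m : ℝ)| := by
  have hk : ∀ k : Fin 4, ((((Torus.proj (2 * L + 1) (Pi.single 0 a) : Fin 4 → ZMod (2 * L + 1)) k -
      (Torus.proj (2 * L + 1) (Pi.single 0 b) : Fin 4 → ZMod (2 * L + 1)) k).valMinAbs : ℤ) : ℝ) ^ 2 =
      if k = 0 then (m : ℝ) ^ 2 else 0 := by
    intro k
    rw [proj_single_sub_proj_single_apply]
    by_cases hk : k = 0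
    · subst hk
      simp only [↓reduceIte]
      rw [hab, valMinAbs_intCast_of_abs_le L hm]
    · simp [hk]
  simp only [hk, Finset.sum_ite_eq', Finset.mem_univ, ↓reduceIte]
  exact Real.sqrt_sq_eq_abs _

/-- Two on-axis torus sites at a non-zero admissible distance are distinct. [folklore] -/
theorem proj_single_ne (L : ℕ) {a b m : ℤ} (hab : ((a - b : ℤ) : ZMod (2 * L + 1)) = (m : ZMod (2 * L + 1)))
    (hm1 : 1 ≤ |m|) (hm : |m| ≤ L) :
    (Torus.proj (2 * L + 1) (Pi.single 0 a) : Fin 4 → ZMod (2 * L + 1)) ≠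
      Torus.proj (2 * L + 1) (Pi.single 0 b) := by
  intro h
  have h0 : (Torus.proj (2 * L + 1) (Pi.single 0 a) : Fin 4 → ZMod (2 * L + 1)) 0 -
      (Torus.proj (2 * L + 1) (Pi.single 0 b) : Fin 4 → ZMod (2 * L + 1)) 0 = 0 := by
    rw [h, sub_self]
  rw [proj_single_sub_proj_single_apply, if_pos rfl, hab] at h0
  have h1 := congrArg ZMod.valMinAbs h0
  rw [valMinAbs_intCast_of_abs_le L hm, ZMod.valMinAbs_zero] at h1
  have : |m| = 0 := by rw [h1, abs_zero]
  omega

/-! ## The pair-ceiling hypothesis at fixed `(β, L)` and the 36-term expansion -/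

/-- **The plaquette-pair ceiling on the odd torus `2L+1` at coupling `β` with constant `C`** — clause 3 of
`FemtoCurvatureTwoPointC.CruxCAt r` at one `(L, β)`, zeta-reduced, with `Γ ≤ 1` absorbed: for torus plaquette
deficits `P x i j = N − Re tr r(U_{∂p})`, `|cov(P x i j, P y i' j')| · dist(x, y)⁸ ≤ C`. (A predicate with
parameters; the hypothesis shape of this file, not a fact.) -/
def PairCeilingAt (r : LatticeRep G) (β : ℝ) (L : ℕ) (C : ℝ) : Prop :=
  ∀ (x y : Fin 4 → ZMod (2 * L + 1)) (i j i' j' : Fin 4), x ≠ y → i ≠ j → i' ≠ j' →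
    |(wilsonExpectation (d := 4) (L := 2 * L + 1) r.ρ β (fun U =>
        ((r.N : ℝ) - (r.ρ (plaquetteHolonomy U x i j)).trace.re) *
          ((r.N : ℝ) - (r.ρ (plaquetteHolonomy U y i' j')).trace.re)) -
      wilsonExpectation (d := 4) (L := 2 * L + 1) r.ρ β (fun U =>
          (r.N : ℝ) - (r.ρ (plaquetteHolonomy U x i j)).trace.re) *
        wilsonExpectation (d := 4) (L := 2 * L + 1) r.ρ β (fun U =>
          (r.N : ℝ) - (r.ρ (plaquetteHolonomy U y i' j')).trace.re))| *
      Real.sqrt (∑ k : Fin 4, (((x k - y k).valMinAbs : ℤ) : ℝ) ^ 2) ^ 8 ≤ C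

section Fixed

variable (r : LatticeRep G) (β : ℝ) (L : ℕ)

/-- The torus plaquette function `U ↦ Re tr r(U_{∂p(x;i,j)})` is measurable (it is a plaquette observable of
the periodic lift at a representative site). [folklore] -/
theorem measurable_reTr_plaquetteHolonomy (x : Site 4) (i j : Fin 4) :
    Measurable fun U : GaugeConfig 4 (2 * L + 1) G =>
      (r.ρ (plaquetteHolonomy U (Torus.proj (2 * L + 1) x) i j)).trace.re := by
  haveI : SecondCountableTopology G := Negative.Freezing.secondCountable_of_latticeRep r
  have h : (fun U : GaugeConfig 4 (2 * L + 1) G =>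
      (r.ρ (plaquetteHolonomy U (Torus.proj (2 * L + 1) x) i j)).trace.re) =
      fun U => plaquetteObs r.ρ x i j (configShift (-0) (torusLift (2 * L + 1) U)) := by
    funext U; rw [plaquetteObs_shift_torusLift, add_zero]
  rw [h]
  exact (measurable_plaquetteObs r.ρ r.continuous x i j).comp
    ((configShift _).measurable.comp (measurable_torusLift _))

omit [IsTopologicalGroup G] [CompactSpace G] [MeasurableSpace G] [BorelSpace G] in
/-- `|Re tr r(U_{∂p})| ≤ N` (unitarity). [folklore] -/
theorem abs_reTr_plaquetteHolonomy_le (x : Fin 4 → ZMod (2 * L + 1)) (i j : Fin 4)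
    (U : GaugeConfig 4 (2 * L + 1) G) :
    |(r.ρ (plaquetteHolonomy U x i j)).trace.re| ≤ r.N :=
  abs_re_trace_le_of_mem_unitaryGroup (r.mem_unitary _)

/-- The torus plaquette functions are in `L²` of the Wilson state. [folklore] -/
theorem memLp_reTr_plaquetteHolonomy (x : Site 4) (i j : Fin 4) :
    MemLp (fun U : GaugeConfig 4 (2 * L + 1) G =>
      (r.ρ (plaquetteHolonomy U (Torus.proj (2 * L + 1) x) i j)).trace.re) 2
      (wilsonMeasure (d := 4) (L := 2 * L + 1) r.ρ β) := by
  haveI := isProbabilityMeasure_wilsonMeasure (d := 4) (L := 2 * L + 1) r.ρ r.continuous β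
  exact MemLp.of_bound (measurable_reTr_plaquetteHolonomy r L x i j).aestronglyMeasurable r.N
    (ae_of_all _ fun U => by
      rw [Real.norm_eq_abs]; exact abs_reTr_plaquetteHolonomy_le r L _ i j U)

/-- **One term.** Under the pair ceiling, the covariance of two torus plaquette functions at sites `π x ≠ π y`
is at most `C / dist⁸` — the ceiling is stated for the deficits `N − Re tr`, whose covariance is the same.
[folklore] -/
theorem abs_cov_reTr_le {C : ℝ} (hC : PairCeilingAt r β L C) (x y : Site 4) {i j i' j' : Fin 4}
    (hxy : Torus.proj (2 * L + 1) x ≠ Torus.proj (2 * L + 1) y) (hij : i ≠ j) (hij' : i' ≠ j') :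
    |cov[fun U : GaugeConfig 4 (2 * L + 1) G =>
        (r.ρ (plaquetteHolonomy U (Torus.proj (2 * L + 1) x) i j)).trace.re,
      fun U => (r.ρ (plaquetteHolonomy U (Torus.proj (2 * L + 1) y) i' j')).trace.re;
      wilsonMeasure (d := 4) (L := 2 * L + 1) r.ρ β]| *
      Real.sqrt (∑ k : Fin 4, (((Torus.proj (2 * L + 1) x k - Torus.proj (2 * L + 1) y k).valMinAbs
        : ℤ) : ℝ) ^ 2) ^ 8 ≤ C := by
  haveI := isProbabilityMeasure_wilsonMeasure (d := 4) (L := 2 * L + 1) r.ρ r.continuous β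
  have h := hC _ _ i j i' j' hxy hij hij'
  -- the covariance of the deficits is the covariance of the plaquette functions
  have hA := memLp_reTr_plaquetteHolonomy r β L x i j
  have hB := memLp_reTr_plaquetteHolonomy r β L y i' j'
  have hcov : cov[fun U : GaugeConfig 4 (2 * L + 1) G =>
        (r.ρ (plaquetteHolonomy U (Torus.proj (2 * L + 1) x) i j)).trace.re,
      fun U => (r.ρ (plaquetteHolonomy U (Torus.proj (2 * L + 1) y) i' j')).trace.re;
      wilsonMeasure (d := 4) (L := 2 * L + 1) r.ρ β] =
      cov[fun U : GaugeConfig 4 (2 * L + 1) G =>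
        (r.N : ℝ) - (r.ρ (plaquetteHolonomy U (Torus.proj (2 * L + 1) x) i j)).trace.re,
      fun U => (r.N : ℝ) - (r.ρ (plaquetteHolonomy U (Torus.proj (2 * L + 1) y) i' j')).trace.re;
      wilsonMeasure (d := 4) (L := 2 * L + 1) r.ρ β] := by
    rw [covariance_const_sub_left (hA.integrable one_le_two),
      covariance_const_sub_right (hB.integrable one_le_two), neg_neg]
  have hA' : MemLp (fun U : GaugeConfig 4 (2 * L + 1) G =>
      (r.N : ℝ) - (r.ρ (plaquetteHolonomy U (Torus.proj (2 * L + 1) x) i j)).trace.re) 2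
      (wilsonMeasure (d := 4) (L := 2 * L + 1) r.ρ β) := (memLp_const _).sub hA
  have hB' : MemLp (fun U : GaugeConfig 4 (2 * L + 1) G =>
      (r.N : ℝ) - (r.ρ (plaquetteHolonomy U (Torus.proj (2 * L + 1) y) i' j')).trace.re) 2
      (wilsonMeasure (d := 4) (L := 2 * L + 1) r.ρ β) := (memLp_const _).sub hB
  have hsub := covariance_eq_sub hA' hB'
  rw [hcov, hsub]
  simpa only [wilsonExpectation, Pi.mul_apply] using h

end Fixed

/-- The set of the six coordinate planes `i < j`. -/
private theorem card_planes : Fintype.card {q : Fin 4 × Fin 4 // q.1 < q.2} = 6 := by decide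

/-- **The 36-term bound.** If every covariance of a plaquette function at `π 0` with a plaquette function at
one of the sites `π (y q')` is at most `B` in absolute value, then the covariance of the two six-plane sums is
at most `36 B`. [folklore] -/
theorem abs_cov_sum_sum_le (r : LatticeRep G) (β : ℝ) (L : ℕ) (x : {q : Fin 4 × Fin 4 // q.1 < q.2} → Site 4)
    (y : {q : Fin 4 × Fin 4 // q.1 < q.2} → Site 4) {B : ℝ}
    (hB : ∀ q q' : {q : Fin 4 × Fin 4 // q.1 < q.2},
      |cov[fun U : GaugeConfig 4 (2 * L + 1) G =>
          (r.ρ (plaquetteHolonomy U (Torus.proj (2 * L + 1) (x q)) q.1.1 q.1.2)).trace.re,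
        fun U => (r.ρ (plaquetteHolonomy U (Torus.proj (2 * L + 1) (y q')) q'.1.1 q'.1.2)).trace.re;
        wilsonMeasure (d := 4) (L := 2 * L + 1) r.ρ β]| ≤ B) :
    |cov[fun U : GaugeConfig 4 (2 * L + 1) G => ∑ q : {q : Fin 4 × Fin 4 // q.1 < q.2},
          (r.ρ (plaquetteHolonomy U (Torus.proj (2 * L + 1) (x q)) q.1.1 q.1.2)).trace.re,
        fun U => ∑ q' : {q : Fin 4 × Fin 4 // q.1 < q.2},
          (r.ρ (plaquetteHolonomy U (Torus.proj (2 * L + 1) (y q')) q'.1.1 q'.1.2)).trace.re;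
        wilsonMeasure (d := 4) (L := 2 * L + 1) r.ρ β]| ≤ 36 * B := by
  haveI := isProbabilityMeasure_wilsonMeasure (d := 4) (L := 2 * L + 1) r.ρ r.continuous β
  rw [covariance_fun_sum_fun_sum (fun q => memLp_reTr_plaquetteHolonomy r β L (x q) q.1.1 q.1.2)
    (fun q' => memLp_reTr_plaquetteHolonomy r β L (y q') q'.1.1 q'.1.2)]
  calc |∑ q, ∑ q', cov[fun U : GaugeConfig 4 (2 * L + 1) G =>
            (r.ρ (plaquetteHolonomy U (Torus.proj (2 * L + 1) (x q)) q.1.1 q.1.2)).trace.re,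
          fun U => (r.ρ (plaquetteHolonomy U (Torus.proj (2 * L + 1) (y q')) q'.1.1 q'.1.2)).trace.re;
          wilsonMeasure (d := 4) (L := 2 * L + 1) r.ρ β]|
      ≤ ∑ q, ∑ q', |cov[fun U : GaugeConfig 4 (2 * L + 1) G =>
            (r.ρ (plaquetteHolonomy U (Torus.proj (2 * L + 1) (x q)) q.1.1 q.1.2)).trace.re,
          fun U => (r.ρ (plaquetteHolonomy U (Torus.proj (2 * L + 1) (y q')) q'.1.1 q'.1.2)).trace.re;
          wilsonMeasure (d := 4) (L := 2 * L + 1) r.ρ β]| :=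
        (Finset.abs_sum_le_sum_abs _ _).trans (Finset.sum_le_sum fun q _ => Finset.abs_sum_le_sum_abs _ _)
    _ ≤ ∑ _q : {q : Fin 4 × Fin 4 // q.1 < q.2}, ∑ _q' : {q : Fin 4 × Fin 4 // q.1 < q.2}, B :=
        Finset.sum_le_sum fun q _ => Finset.sum_le_sum fun q' _ => hB q q'
    _ = 36 * B := by
        rw [Finset.sum_const, Finset.sum_const, Finset.card_univ, card_planes, nsmul_eq_mul, nsmul_eq_mul]
        push_cast
        ring

/-! ## One on-axis term under the pair ceiling -/

section Axis

variable (r : LatticeRep G) {β C : ℝ} {L : ℕ}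

/-- The pair ceiling forces `0 ≤ C` (instance: two distinct on-axis sites; `L ≥ 1`). [folklore] -/
theorem pairCeiling_nonneg (hC : PairCeilingAt r β L C) (hL : 1 ≤ L) : 0 ≤ C := by
  have hne := proj_single_ne L (a := 1) (b := 0) (m := 1) (by push_cast; ring_nf) (by simp) (by simp; omega)
  have h := hC _ _ 0 1 0 1 hne (by decide) (by decide)
  exact le_trans (mul_nonneg (abs_nonneg _) (pow_nonneg (Real.sqrt_nonneg _) _)) h

/-- **One on-axis term.** Under the pair ceiling with constant `C`, the covariance of the torus plaquette
functions at `π(a e₀)` and `π(b e₀)` with `a − b ≡ m`, `1 ≤ |m| ≤ L`, is at most `C / |m|⁸` in absolute value.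
[folklore] -/
theorem abs_cov_axis_le (hC : PairCeilingAt r β L C) {a b m : ℤ}
    (hab : ((a - b : ℤ) : ZMod (2 * L + 1)) = (m : ZMod (2 * L + 1))) (hm1 : 1 ≤ |m|) (hm : |m| ≤ L)
    {i j i' j' : Fin 4} (hij : i ≠ j) (hij' : i' ≠ j') :
    |cov[fun U : GaugeConfig 4 (2 * L + 1) G =>
        (r.ρ (plaquetteHolonomy U (Torus.proj (2 * L + 1) (Pi.single 0 a)) i j)).trace.re,
      fun U => (r.ρ (plaquetteHolonomy U (Torus.proj (2 * L + 1) (Pi.single 0 b)) i' j')).trace.re;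
      wilsonMeasure (d := 4) (L := 2 * L + 1) r.ρ β]| ≤ C / |(m : ℝ)| ^ 8 := by
  have h := abs_cov_reTr_le r β L hC (Pi.single 0 a) (Pi.single 0 b) (proj_single_ne L hab hm1 hm) hij hij'
  rw [torusDist_axis L hab hm] at h
  have hmpos : 0 < |(m : ℝ)| := by
    rw [← Int.cast_abs]; exact_mod_cast (show (0 : ℤ) < |m| by omega)
  rwa [le_div_iff₀ (pow_pos hmpos 8)]

/-- The bound `C / |m|⁸ ≤ C / (D-1)⁸` for `D - 1 ≤ |m|`. [folklore] -/
theorem div_abs_pow_le (hC0 : 0 ≤ C) {m : ℤ} {D : ℕ} (h2 : 2 ≤ D) (hDm : (D : ℤ) - 1 ≤ |m|) :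
    C / |(m : ℝ)| ^ 8 ≤ C / ((D : ℝ) - 1) ^ 8 := by
  have hD1 : (0 : ℝ) < (D : ℝ) - 1 := by
    have : (2 : ℝ) ≤ D := by exact_mod_cast h2
    linarith
  have hle : (D : ℝ) - 1 ≤ |(m : ℝ)| := by
    rw [← Int.cast_abs]; exact_mod_cast hDm
  exact div_le_div_of_nonneg_left hC0 (pow_pos hD1 8) (pow_le_pow_left₀ hD1.le hle 8)

end Axis

end Summit.QuantumFields.YangMills.Theorems.TunedSequenceExists.PairCeiling

end
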